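import Literature.NumberTheory.GaloisCohomology.Howard2004.DVRKolyvaginBound
import Literature.NumberTheory.GaloisCohomology.Howard2004.FiniteSingularNatural
import HarnessLib

/-!
# Howard 2004, Def. 1.2.3 / §1.6 over a general coefficient ring: tower settings and their
Kolyvagin systems (`CoeffTowerSetting`), with the DVR case as `DVRSetting`

Tranche 3c of (W9) (cell `pub/bsd-print-x9`; x9-p1 LEAD ask (T3-i), 2026-08-28 14:56Z «the
critical path of STUB 2 (P-KS)»).  Howard's Kolyvagin systems `KS(T, F, 𝓛)` (Def. 1.2.3) make
sense for `T` over ANY coefficient ring `R` (complete Noetherian local, finite residue field;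
«the cases of interest are … `𝒪`, a quotient of `𝒪`, or the Iwasawa algebra `Λ`», arXiv p. 4
L47–50): the compact `T` is the tower of its finite levels `T/𝔪^{e_k}T`, `T/I_nT` the tower of the
finite `T/(I_n + 𝔪^{e_k})T`, and a Kolyvagin system is the level-compatible family of classes
`κ_n` with the (ks) relations at every level — the shape of `DVRSetting.KolyvaginSystem`
(LEAD coupling (L4)), which for `R = Λ` (`𝔪 = (p, T)`, CGLS 2022 Thm. 4.1.1: `κ^{Hg} ∈
KS(𝐓, F_Λ, 𝓛_E)`) is Howard's continuous-cohomology reading (journal §2.2 ¶1).  This file: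
* `CoeffTowerSetting p K R N Rk Nbar Nq` — the `κ`-free data of `DVRSetting` with the DVR
  hypotheses on `R` dropped (`[CommRing R] [IsLocalRing R] [Algebra ℤ_[p] R]`) and no uniformizer;
* `CoeffTowerSetting.rqH1 / rqLocH1 / KolyvaginSystem / LargePrimes` — verbatim as for `DVRSetting`;
* `CoeffTowerSetting.FsNatural`, `CoeffTowerSetting.FsAdmissible` — naturality of the finite–singular
  slots along the reductions, and their PIN to Def. 1.1.8 (tranche 4, `LevelData.IsFsAdmissible`);
* `DVRSetting.toCoeffTowerSetting` and the conversions `KolyvaginSystem.ofCoeff / toCoeff`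
  (field-by-field, definitional), so that a Kolyvagin system produced over the general setting
  (e.g. by ring change from `Λ`) feeds `thm161_dvrKolyvaginBound` unchanged.
Definitions with bodies and `rfl`-level lemmas only; no named fact, no `sorry`, no instance.
[cite: Howard2004HeegnerKolyvagin, Def. 1.2.3 and Rem. 1.2.4 (arXiv p. 7, L1–27); §1 conventions (arXiv p. 4, L47–52)]
-/

set_option autoImplicit false

noncomputable section

open Function NumberField IsDedekindDomain Field
open scoped NumberField ContRepresentation Classical TensorProduct

namespace Literature.NumberTheory.GaloisCohomology.Howard2004

open Literature.NumberTheory.GaloisRepresentations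
open Literature.NumberTheory.GaloisRepresentations.DiscreteGaloisModule

/-- **The tower setting over a general coefficient ring** (the data of `DVRSetting` without the
discrete-valuation hypotheses and the uniformizer): the exact `𝔪`-adic tower of a compact `T`
with its level rings, the conjugation datum, `Σ(F)`, `𝓛`, the level Selmer triples, the residual
presentation and `G_ℚ`-structure, the duality data, the presentations of `T^{(k)}/I_n` with their
pinned reductions and the finite–singular slots.  For `R = Λ` this carries `(𝐓, F_Λ, 𝓛_E)`.
[cite: Howard2004HeegnerKolyvagin, §1 conventions and Def. 1.2.3 (arXiv p. 4 L47–52, p. 7 L1–12)] -/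
structure CoeffTowerSetting (p : ℕ) [Fact p.Prime] (K : Type) [Field K] [NumberField K]
    (R : Type) [CommRing R] [IsLocalRing R] [Algebra ℤ_[p] R]
    (N : ℕ → Type) [∀ k, AddCommGroup (N k)] [∀ k, TopologicalSpace (N k)]
    [∀ k, DiscreteTopology (N k)] [∀ k, Module R (N k)]
    (Rk : ℕ → Type) [∀ k, CommRing (Rk k)] [∀ k, IsLocalRing (Rk k)] [∀ k, TopologicalSpace (Rk k)]
    [∀ k, DiscreteTopology (Rk k)] [∀ k, Algebra ℤ_[p] (Rk k)] [∀ k, Algebra R (Rk k)]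
    [∀ k, Module (Rk k) (N k)] [∀ k, IsScalarTower R (Rk k) (N k)]
    (Nbar : Type) [AddCommGroup Nbar] [TopologicalSpace Nbar] [DiscreteTopology Nbar]
    [∀ k, Module (Rk k) Nbar]
    (Nq : ℕ → Finset (HeightOneSpectrum (𝓞 K)) → Type) [∀ k n, AddCommGroup (Nq k n)]
    [∀ k n, TopologicalSpace (Nq k n)] [∀ k n, DiscreteTopology (Nq k n)]
    [∀ k n, Module (Rk k) (Nq k n)] [∀ k n, Module R (Nq k n)]
    [∀ k n, IsScalarTower R (Rk k) (Nq k n)] where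
  /-- the exponents: level `k` is `T/𝔪^{e_k}` -/
  e : ℕ → ℕ
  /-- the tower `T` -/
  T : AdicTower K R N
  /-- complex conjugation -/
  cd : ConjugationDatum K
  /-- a complex embedding of `K̄` (for the ring class fields of the transverse condition) -/
  jbar : AlgebraicClosure K →+* ℂ
  /-- `Σ(F)` -/
  Sigma : Finset (Place K)
  /-- the prime set `𝓛` -/
  L : Set (HeightOneSpectrum (𝓞 K))
  /-- the Selmer triple `(T^{(k)}, F, 𝓛)` on level `k` -/
  t : ∀ k, SelmerTriple p (T.ρ k)
  /-- residual representation `T̄` -/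
  ρbar : DiscreteGaloisModule K Nbar
  /-- `T^{(k)} ↠ T̄` -/
  πbar : ∀ k, N k →ₗ[Rk k] Nbar
  /-- the `G_ℚ`-structure on `T̄` (H.5(a)), seen `R_k`-linearly at each level -/
  A : ∀ k, ResidualTau (R := Rk k) cd ρbar
  /-- the duality data of H.4 on the levels -/
  D : ∀ k, DualityDatum p cd (T.ρ k) (Rk k)
  /-- the reductions `R_{k+1} → R_k` -/
  redR : ∀ k, Rk (k + 1) →+* Rk k
  /-- presentations of `T^{(k)}/I_n T^{(k)}` and the finite–singular slots at level `k` -/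
  LD : ∀ k, LevelData (Rk k) (T.ρ k) (t k) (Nq k)
  /-- the reductions `T^{(k+1)}/I_n → T^{(k)}/I_n` -/
  rq : ∀ k n, Nq (k + 1) n →ₗ[R] Nq k n
  rq_comp : ∀ k n (x : N (k + 1)), rq k n ((LD (k + 1)).π n x) = (LD k).π n (T.red k x)
  rq_equivariant : ∀ k n (g : absoluteGaloisGroup K) (y : Nq (k + 1) n),
    rq k n ((LD (k + 1)).ρq n g y) = (LD k).ρq n g (rq k n y)
  /-- the singular quotients along the reductions (pinned by `fsQ_spec`) -/
  fsQ : ∀ k n (v : HeightOneSpectrum (𝓞 K)),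
    SingularQuotient (GaloisRep.toLocal v ((LD (k + 1)).ρq n)) →+
      SingularQuotient (GaloisRep.toLocal v ((LD k).ρq n))


namespace CoeffTowerSetting

variable {p : ℕ} [Fact p.Prime] {K : Type} [Field K] [NumberField K]
  {R : Type} [CommRing R] [IsLocalRing R] [Algebra ℤ_[p] R]
  {N : ℕ → Type} [∀ k, AddCommGroup (N k)] [∀ k, TopologicalSpace (N k)]
  [∀ k, DiscreteTopology (N k)] [∀ k, Module R (N k)]
  {Rk : ℕ → Type} [∀ k, CommRing (Rk k)] [∀ k, IsLocalRing (Rk k)] [∀ k, TopologicalSpace (Rk k)]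
  [∀ k, DiscreteTopology (Rk k)] [∀ k, Algebra ℤ_[p] (Rk k)] [∀ k, Algebra R (Rk k)]
  [∀ k, Module (Rk k) (N k)] [∀ k, IsScalarTower R (Rk k) (N k)]
  {Nbar : Type} [AddCommGroup Nbar] [TopologicalSpace Nbar] [DiscreteTopology Nbar]
  [∀ k, Module (Rk k) Nbar]
  {Nq : ℕ → Finset (HeightOneSpectrum (𝓞 K)) → Type} [∀ k n, AddCommGroup (Nq k n)]
  [∀ k n, TopologicalSpace (Nq k n)] [∀ k n, DiscreteTopology (Nq k n)]
  [∀ k n, Module (Rk k) (Nq k n)] [∀ k n, Module R (Nq k n)]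
  [∀ k n, IsScalarTower R (Rk k) (Nq k n)]

/-- `H¹` of the reduction `T^{(k+1)}/I_n → T^{(k)}/I_n`. [cite: Howard2004HeegnerKolyvagin, Def. 1.2.3 (arXiv p. 7, L1–12)] -/
def rqH1 (S : CoeffTowerSetting p K R N Rk Nbar Nq) (k : ℕ) (n : Finset (HeightOneSpectrum (𝓞 K))) :
    galoisCohomology ((S.LD (k + 1)).ρq n) 1 →+ galoisCohomology ((S.LD k).ρq n) 1 :=
  ContinuousRep.cohomologyMap ((S.LD (k + 1)).ρq n) ((S.LD k).ρq n) (S.rq k n).toAddMonoidHom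
    continuous_of_discreteTopology (S.rq_equivariant k n) 1

/-- The same on local cohomology at a finite place. [cite: Howard2004HeegnerKolyvagin, Def. 1.2.3 (arXiv p. 7, L1–12)] -/
def rqLocH1 (S : CoeffTowerSetting p K R N Rk Nbar Nq) (k : ℕ) (n : Finset (HeightOneSpectrum (𝓞 K)))
    (v : HeightOneSpectrum (𝓞 K)) :
    galoisCohomology (GaloisRep.toLocal v ((S.LD (k + 1)).ρq n)) 1 →+
      galoisCohomology (GaloisRep.toLocal v ((S.LD k).ρq n)) 1 :=
  ContinuousRep.cohomologyMap (GaloisRep.toLocal v ((S.LD (k + 1)).ρq n))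
    (GaloisRep.toLocal v ((S.LD k).ρq n)) (S.rq k n).toAddMonoidHom
    continuous_of_discreteTopology (fun _ y => S.rq_equivariant k n _ y) 1

/-- **«suppose `𝓛_s(T) ⊂ 𝓛` for `s ≫ 0`»** over the general setting. [cite: Howard2004HeegnerKolyvagin, §1.6 (arXiv p. 11, L15–16)] -/
def LargePrimes (S : CoeffTowerSetting p K R N Rk Nbar Nq) : Prop :=
  ∃ s₀ : ℕ, ∀ s, s₀ ≤ s → S.T.kolyvaginPrimes p s ⊆ S.L

/-- The finite–singular slots are natural along the reductions (`fsQ` is THE induced map on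
singular quotients and `φ^{fs}` commutes with reduction) — the naturality LEAD (L4) asks of the
slots so that functoriality of `KS` can be stated. [cite: Howard2004HeegnerKolyvagin, Def. 1.2.3, display (ks relations) (arXiv p. 6, L126–140)] -/
def FsNatural (S : CoeffTowerSetting p K R N Rk Nbar Nq) : Prop :=
  (∀ k n (v : HeightOneSpectrum (𝓞 K))
      (x : galoisCohomology (GaloisRep.toLocal v ((S.LD (k + 1)).ρq n)) 1),
    S.fsQ k n v (singularMap _ x) = singularMap _ (S.rqLocH1 k n v x)) ∧
  ∀ k n (v : HeightOneSpectrum (𝓞 K))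
      (x : galoisCohomology (GaloisRep.toLocal v ((S.LD (k + 1)).ρq n)) 1),
    (S.LD k).fs n v (S.rqLocH1 k n v x) =
      TensorProduct.map (S.fsQ k n v).toIntLinearMap LinearMap.id ((S.LD (k + 1)).fs n v x)

/-- **The finite–singular slots are THE comparison maps of Def. 1.1.8** over the general setting
(tranche 4, the pin of reading note (i): at every level `k`, `(LD k).fs` is bijective on the finite
classes and natural in the module, `LevelData.IsFsAdmissible`; reading note (v) of
`FiniteSingularNatural.lean`) — the clause under which a statement over the slots (e.g. the
KS-membership of CGLS 2022 Thm. 4.1.1 over `R = Λ`) is not stronger than print; the DVR form is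
`DVRSetting.SatisfiesH.fs_admissible`.
[cite: Howard2004HeegnerKolyvagin, Def. 1.1.8 and Def. 1.2.3 (arXiv p. 5 L126–131, p. 7 L1–12)] -/
def FsAdmissible (S : CoeffTowerSetting p K R N Rk Nbar Nq) : Prop :=
  ∀ k, (S.LD k).IsFsAdmissible

/-- **A Kolyvagin system `κ ∈ KS(T, F, 𝓛)` over the general setting** (Def. 1.2.3 in tower form,
verbatim the DVR version): level Kolyvagin systems `κ^{(k)} ∈ KS(T^{(k)}, F, 𝓛)` (the (ks)
relations), compatible under the reductions, with the bottom class `κ_1 ∈ H¹_F(K, T) = lim`.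
[cite: Howard2004HeegnerKolyvagin, Def. 1.2.3 (arXiv p. 7, L1–12)] -/
structure KolyvaginSystem (S : CoeffTowerSetting p K R N Rk Nbar Nq) where
  /-- the level classes `κ^{(k)}_n` -/
  κ : ∀ k n, ↥((S.LD k).selmerAt S.jbar n) ⊗[ℤ] Gn (K := K) n
  ks : ∀ k, κ k ∈ (S.LD k).KS S.jbar
  κ_red : ∀ k n,
    TensorProduct.map ((S.rqH1 k n).comp ((S.LD (k + 1)).selmerAt S.jbar n).subtype).toIntLinearMap
        LinearMap.id (κ (k + 1) n) =
      TensorProduct.map ((S.LD k).selmerAt S.jbar n).subtype.toIntLinearMap LinearMap.id (κ k n)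
  /-- the bottom class `κ_1 ∈ H¹_F(K, T) = lim_k H¹_F(K, T^{(k)})` -/
  one : ∀ k, galoisCohomology (S.T.ρ k) 1
  one_mem : one ∈ S.T.limitSelmer fun k => (S.t k).cond
  κ_one : ∀ k, TensorProduct.map ((S.LD k).selmerAt S.jbar ∅).subtype.toIntLinearMap LinearMap.id
      (κ k ∅) =
    ((S.LD k).isQuotientBy ∅).cohomologyMap 1 (one k) ⊗ₜ[ℤ] (gnEmptyEquiv (K := K)).symm 1

end CoeffTowerSetting

namespace DVRSetting

variable {p : ℕ} [Fact p.Prime] {K : Type} [Field K] [NumberField K]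
  {R : Type} [CommRing R] [IsDomain R] [IsDiscreteValuationRing R] [Algebra ℤ_[p] R]
  {N : ℕ → Type} [∀ k, AddCommGroup (N k)] [∀ k, TopologicalSpace (N k)]
  [∀ k, DiscreteTopology (N k)] [∀ k, Module R (N k)]
  {Rk : ℕ → Type} [∀ k, CommRing (Rk k)] [∀ k, IsLocalRing (Rk k)] [∀ k, TopologicalSpace (Rk k)]
  [∀ k, DiscreteTopology (Rk k)] [∀ k, Algebra ℤ_[p] (Rk k)] [∀ k, Algebra R (Rk k)]
  [∀ k, Module (Rk k) (N k)] [∀ k, IsScalarTower R (Rk k) (N k)]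
  {Nbar : Type} [AddCommGroup Nbar] [TopologicalSpace Nbar] [DiscreteTopology Nbar]
  [∀ k, Module (Rk k) Nbar]
  {Nq : ℕ → Finset (HeightOneSpectrum (𝓞 K)) → Type} [∀ k n, AddCommGroup (Nq k n)]
  [∀ k n, TopologicalSpace (Nq k n)] [∀ k n, DiscreteTopology (Nq k n)]
  [∀ k n, Module (Rk k) (Nq k n)] [∀ k n, Module R (Nq k n)]
  [∀ k n, IsScalarTower R (Rk k) (Nq k n)]

/-- The general tower setting underlying a DVR setting (forget `π`). [cite: Howard2004HeegnerKolyvagin, §1.6 (arXiv p. 11, L13–16)] -/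
def toCoeffTowerSetting (S : DVRSetting p K R N Rk Nbar Nq) : CoeffTowerSetting p K R N Rk Nbar Nq where
  e := S.e
  T := S.T
  cd := S.cd
  jbar := S.jbar
  Sigma := S.Sigma
  L := S.L
  t := S.t
  ρbar := S.ρbar
  πbar := S.πbar
  A := S.A
  D := S.D
  redR := S.redR
  LD := S.LD
  rq := S.rq
  rq_comp := S.rq_comp
  rq_equivariant := S.rq_equivariant
  fsQ := S.fsQ

/-- A Kolyvagin system over the underlying general setting is one for the DVR setting (same data).
[cite: Howard2004HeegnerKolyvagin, Def. 1.2.3 (arXiv p. 7, L1–12)] -/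
def KolyvaginSystem.ofCoeff {S : DVRSetting p K R N Rk Nbar Nq}
    (κ : S.toCoeffTowerSetting.KolyvaginSystem) : S.KolyvaginSystem where
  κ := κ.κ
  ks := κ.ks
  κ_red := κ.κ_red
  one := κ.one
  one_mem := κ.one_mem
  κ_one := κ.κ_one

/-- … and conversely. [cite: Howard2004HeegnerKolyvagin, Def. 1.2.3 (arXiv p. 7, L1–12)] -/
def KolyvaginSystem.toCoeff {S : DVRSetting p K R N Rk Nbar Nq} (κ : S.KolyvaginSystem) :
    S.toCoeffTowerSetting.KolyvaginSystem where
  κ := κ.κ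
  ks := κ.ks
  κ_red := κ.κ_red
  one := κ.one
  one_mem := κ.one_mem
  κ_one := κ.κ_one

/-- The bottom class is unchanged by the conversion. [cite: Howard2004HeegnerKolyvagin, Def. 1.2.3 (arXiv p. 7, L1–12)] -/
@[simp] theorem KolyvaginSystem.ofCoeff_one {S : DVRSetting p K R N Rk Nbar Nq}
    (κ : S.toCoeffTowerSetting.KolyvaginSystem) : (KolyvaginSystem.ofCoeff κ).one = κ.one := rfl

/-- `LargePrimes` is the same predicate on both settings. [cite: Howard2004HeegnerKolyvagin, §1.6 (arXiv p. 11, L15–16)] -/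
theorem largePrimes_toCoeffTowerSetting (S : DVRSetting p K R N Rk Nbar Nq) :
    S.toCoeffTowerSetting.LargePrimes ↔ S.LargePrimes := Iff.rfl

end DVRSetting

end Literature.NumberTheory.GaloisCohomology.Howard2004
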